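import Summits.QuantumFields.BalabanUV.Beta.GAN24.ExchangeSlotLiteral
import Summits.QuantumFields.BalabanUV.Beta.GAN24.EEWordReduced

/-!
# (C)sym at level 0 — THE EE EXCHANGE WORD OF THE DRESSED SOURCE IS ONE NUMBER: `ee_word_value` (blueprint §5∕§6 (L1), corrected by C-leaf04-g65-1)

WHAT. The literal two-face-read EE exchange word of the dressed level-0 source, first bond over one cell of the coarse lattice, second bond and all legs over the lattice —
`Σ_{u ∈ box Lc} Σ'_{u′} Σ'_{(y,w)} 𝟙f(y_α)𝟙f(w_β)·((V_{μ,u} ∘ X̃♮_0) ∘ V_{ν,u′}) y w (inl α)(inl β)` (`V_{κ,v} = vertexOfK X̃♮_0 Lc S^E κ v`, `X̃♮_0 = unitK s_f s_m (coDressKBmAt ρ Lc (KInvStep Lc 0))`,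
`S^E = unitS s_f s_m (cE • wilsonA)`, in-block root, `1 ≤ Lc`, all units, `μ ≠ α`, `ν ≠ β`) — EQUALS `−K₁²·s_f²·E·½·Lc^{d−1}·(Lc^{d+1} − Lc^{d−1})`,
`E = [μ=ν][α=β] − [μ=β][α=ν]`, `K₁ = (Lc·s_m s_f·Lc^{−(d+2)})·((s_f s_m)⁻¹ s_f⁻² cE)`.

* §1 **`fubini3`** — an abstract three-fold Fubini for `Σ_b Σ'_{(y,z)} f(y)·(Σ'_{y₁} Σ_a V(y,y₁,a)·X(y₁,z,a,b))·T(b,z) = Σ'_{y₁} Σ_a (Σ'_y f·V)·(Σ'_z Σ_b X·T)` under the majorants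
  `|f| ≤ 1`, `|V(y,y₁,a)| ≤ C_v e^{−δ(|y−c|+|y₁−c|)}`, `|X(y₁,z,a,b)| ≤ C_X e^{−δ|y₁−z|}`, `|T| ≤ M` (master family on `(Site × Site) × Site`, `summable_prod_of_nonneg`,
  `ExchangeSlotFubini.exp_pair_le`, `Summable.tsum_mul_tsum`, `Summable.tsum_prod` and the swap equivalence);
* §2 **`ee_word_outer_fubini`** (per first bond): the literal word resummed over its second bond (`ExchangeSlotLiteral.hasSum_literal_slot`) with the right slot in nested form
  (`ExchangeFieldLegs.tsum_prod_faceHalfVertex`) IS the reduced word of `EEWordReduced` (§1 with the decay data of the dressed source; the resummed right slot is the bounded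
  block-periodic current `K₁·(+½·curvAdj F_{νβ})` of `DressedWilsonHalfVertex.hasSum_faceHalfVertex_snd`);
* §3 **`ee_word_value`** — the number, by `EEWordReduced.ee_word_reduced′`.

HONEST: [folklore] `tsum` bookkeeping BY NAME over this lineage's GAN24 files 9 ∕ 10 ∕ 15 ∕ 16 ∕ 17 and an2's kernel calculus; no value of Bałaban's tables beyond an3's DEFINED stencil is
asserted; the number is piece (II) (the EE exchange word) of the level-0 (C_1) balance ONLY — (I)'s junction with p2's `zmode_succ_eq_fourFace` and (III) remain; (C)sym stays DISPLAYED —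
nothing of (C)∕(Q-D)∕(Q-D-rate) is discharged; NEVER «G-an2-4 closed» as (CONV-C); NOT D1, NOT BetaPertH, NOT continuum, NOT Clay.
-/

noncomputable section

open Finset
open scoped BigOperators
open Literature.MathematicalPhysics.QuantumFieldTheory
open Literature.MathematicalPhysics.QuantumFieldTheory.Balaban1983to89
open Literature.MathematicalPhysics.QuantumFieldTheory.Balaban1983to89.Beta
open B12Sec2to5 (l1 l1_nonneg)
open ExpKernelCalculus (Site MKer comp Decays BiLoc VertexFamily Zl Zl_nonneg summable_exp_shift summable_exp_shift' tsum_exp_shift')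
open OneStepResolventKernel (Fib LocStencil decays_mono)
open OneStepKernelFamily (KInvStep vertexOfK vertexFamily_vertexOfK decays_KInvStep)
open StepJetData (wilsonA locStencil_wilsonA locStencil_smul)
open AffineAveraging (Form2 box toSite curvAdj)
open PeriodicDescent (IsPeriodic)
open Summit.QuantumFields.BalabanUV.Beta.AxialDressingRooted (coDressKBmAt decays_coDressKBmAt)
open Summit.QuantumFields.BalabanUV.Beta.HessKerDressedUnits (unitK unitS decays_unitK locStencil_unitS)
open Summit.QuantumFields.BalabanUV.Beta.GAN24.PeriodicForceMultiplier (bounded_of_periodic)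
open Summit.QuantumFields.BalabanUV.Beta.GAN24.ExchangeSlotFubini (exp_pair_le)
open Summit.QuantumFields.BalabanUV.Beta.GAN24.DressedWilsonHalfVertex (hasSum_faceHalfVertex_snd)
open Summit.QuantumFields.BalabanUV.Beta.GAN24.DressedKernelOnFaceCurrent (smul_curvAdj_periodic facePlaq_periodic)
open Summit.QuantumFields.BalabanUV.Beta.GAN24.ExchangeFieldLegs (tsum_prod_faceHalfVertex)
open Summit.QuantumFields.BalabanUV.Beta.GAN24.ExchangeSlotLiteral (hasSum_literal_slot)
open Summit.QuantumFields.BalabanUV.Beta.GAN24.EEWordReduced (ee_word_reduced')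

namespace Summit.QuantumFields.BalabanUV.Beta.GAN24.EEWordValue

variable {d : ℕ}

/-! ## §1 An abstract three-fold Fubini -/

set_option maxHeartbeats 400000 in
/-- [folklore] **THREE-FOLD FUBINI FOR THE EE WORD**: with `|f| ≤ 1`, `|V(y,y₁,a)| ≤ C_v e^{−δ(|y−c|+|y₁−c|)}`, `|X(y₁,z,a,b)| ≤ C_X e^{−δ|y₁−z|}`, `|T(b,z)| ≤ M`,
`Σ_b Σ'_{(y,z)} f(y)·(Σ'_{y₁} Σ_a V(y,y₁,a)·X(y₁,z,a,b))·T(b,z) = Σ'_{y₁} Σ_a (Σ'_y f(y)·V(y,y₁,a))·(Σ'_z Σ_b X(y₁,z,a,b)·T(b,z))` — both are the total of the absolutely summable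
family `f(y)·V(y,y₁,a)·X(y₁,z,a,b)·T(b,z)` on `(Site × Site) × Site` per finite leg pair. -/
theorem fubini3 {ι : Type*} [Fintype ι] {f : Site (d + 1) → ℝ} {V : Site (d + 1) → Site (d + 1) → ι → ℝ} {X : Site (d + 1) → Site (d + 1) → ι → ι → ℝ}
    {T : ι → Site (d + 1) → ℝ} {Cv CX M δ : ℝ} {c : Site (d + 1)} (hδ : 0 < δ) (hCv : 0 ≤ Cv) (hCX : 0 ≤ CX) (hM : 0 ≤ M)
    (hf : ∀ y, |f y| ≤ 1) (hV : ∀ y y₁ a, |V y y₁ a| ≤ Cv * Real.exp (-δ * (l1 (y - c) + l1 (y₁ - c))))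
    (hX : ∀ y₁ z a b, |X y₁ z a b| ≤ CX * Real.exp (-δ * l1 (y₁ - z))) (hT : ∀ b z, |T b z| ≤ M) :
    ∑ b, ∑' yz : Site (d + 1) × Site (d + 1), f yz.1 * (∑' y₁ : Site (d + 1), ∑ a, V yz.1 y₁ a * X y₁ yz.2 a b) * T b yz.2 =
      ∑' y₁ : Site (d + 1), ∑ a, (∑' y : Site (d + 1), f y * V y y₁ a) * (∑' z : Site (d + 1), ∑ b, X y₁ z a b * T b z) := by
  classical
  -- the master family per leg pair and its majorant
  set Ψ : ι → ι → (Site (d + 1) × Site (d + 1)) × Site (d + 1) → ℝ := fun a b p => f p.1.1 * V p.1.1 p.2 a * X p.2 p.1.2 a b * T b p.1.2 with hΨ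
  set Mj : (Site (d + 1) × Site (d + 1)) × Site (d + 1) → ℝ := fun p =>
    (Cv * CX * M) * Real.exp (-δ * l1 (p.1.1 - c)) * (Real.exp (-δ * l1 (p.2 - c)) * Real.exp (-δ * l1 (p.2 - p.1.2))) with hMj
  have hMj0 : 0 ≤ Mj := fun p => by positivity
  have hΨle : ∀ a b p, |Ψ a b p| ≤ Mj p := by
    intro a b p
    have h1 := hf p.1.1
    have h2 := hV p.1.1 p.2 a
    have h3 := hX p.2 p.1.2 a b
    have h4 := hT b p.1.2
    rw [mul_add, Real.exp_add, ← mul_assoc] at h2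
    have e1 : |Ψ a b p| = |f p.1.1| * |V p.1.1 p.2 a| * |X p.2 p.1.2 a b| * |T b p.1.2| := by
      simp only [hΨ, abs_mul]
    rw [e1]
    have s1 : |f p.1.1| * |V p.1.1 p.2 a| ≤ 1 * (Cv * Real.exp (-δ * l1 (p.1.1 - c)) * Real.exp (-δ * l1 (p.2 - c))) :=
      mul_le_mul h1 h2 (abs_nonneg _) zero_le_one
    have s2 : |f p.1.1| * |V p.1.1 p.2 a| * |X p.2 p.1.2 a b| ≤
        1 * (Cv * Real.exp (-δ * l1 (p.1.1 - c)) * Real.exp (-δ * l1 (p.2 - c))) * (CX * Real.exp (-δ * l1 (p.2 - p.1.2))) :=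
      mul_le_mul s1 h3 (abs_nonneg _) (by positivity)
    have s3 : |f p.1.1| * |V p.1.1 p.2 a| * |X p.2 p.1.2 a b| * |T b p.1.2| ≤
        1 * (Cv * Real.exp (-δ * l1 (p.1.1 - c)) * Real.exp (-δ * l1 (p.2 - c))) * (CX * Real.exp (-δ * l1 (p.2 - p.1.2))) * M :=
      mul_le_mul s2 h4 (abs_nonneg _) (by positivity)
    refine s3.trans (le_of_eq ?_)
    simp only [hMj]
    ring
  -- the majorant is summable on `(Site × Site) × Site`
  have hMjs : Summable Mj := by
    refine (summable_prod_of_nonneg hMj0).2 ⟨fun yz => ?_, ?_⟩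
    · refine Summable.of_nonneg_of_le (fun y₁ => hMj0 (yz, y₁)) (fun y₁ => ?_)
        ((summable_exp_shift' hδ c).mul_left ((Cv * CX * M) * Real.exp (-δ * l1 (yz.1 - c))))
      show (Cv * CX * M) * Real.exp (-δ * l1 (yz.1 - c)) * (Real.exp (-δ * l1 (y₁ - c)) * Real.exp (-δ * l1 (y₁ - yz.2))) ≤
        (Cv * CX * M) * Real.exp (-δ * l1 (yz.1 - c)) * Real.exp (-δ * l1 (y₁ - c))
      refine mul_le_mul_of_nonneg_left ?_ (by positivity)
      exact mul_le_of_le_one_right (Real.exp_pos _).le (Real.exp_le_one_iff.2 (by nlinarith [l1_nonneg (y₁ - yz.2)]))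
    · have hB : Summable fun yz : Site (d + 1) × Site (d + 1) =>
          ((Cv * CX * M) * Real.exp (-δ * l1 (yz.1 - c))) * (Zl (d + 1) (δ / 2) * Real.exp (-(δ / 2) * l1 (c - yz.2))) :=
        Summable.mul_of_nonneg ((summable_exp_shift' hδ c).mul_left (Cv * CX * M)) ((summable_exp_shift (half_pos hδ) c).mul_left (Zl (d + 1) (δ / 2)))
          (fun y => show (0 : ℝ) ≤ _ by positivity) (fun z => mul_nonneg (Zl_nonneg (half_pos hδ)) (Real.exp_pos _).le)
      refine Summable.of_nonneg_of_le (fun yz => tsum_nonneg fun y₁ => hMj0 (yz, y₁)) (fun yz => ?_) hB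
      show ∑' y₁ : Site (d + 1), (Cv * CX * M) * Real.exp (-δ * l1 (yz.1 - c)) * (Real.exp (-δ * l1 (y₁ - c)) * Real.exp (-δ * l1 (y₁ - yz.2))) ≤ _
      rw [tsum_mul_left]
      refine mul_le_mul_of_nonneg_left ?_ (by positivity)
      have hpt : ∀ y₁ : Site (d + 1), Real.exp (-δ * l1 (y₁ - c)) * Real.exp (-δ * l1 (y₁ - yz.2)) ≤
          Real.exp (-(δ / 2) * l1 (y₁ - yz.2)) * Real.exp (-(δ / 2) * l1 (c - yz.2)) := by
        intro y₁
        rw [mul_comm]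
        exact exp_pair_le hδ.le y₁ yz.2 c
      have hs1 : Summable fun y₁ : Site (d + 1) => Real.exp (-δ * l1 (y₁ - c)) * Real.exp (-δ * l1 (y₁ - yz.2)) :=
        Summable.of_nonneg_of_le (fun _ => by positivity)
          (fun y₁ => mul_le_of_le_one_right (Real.exp_pos _).le (Real.exp_le_one_iff.2 (by nlinarith [l1_nonneg (y₁ - yz.2)]))) (summable_exp_shift' hδ c)
      have hs2 : Summable fun y₁ : Site (d + 1) => Real.exp (-(δ / 2) * l1 (y₁ - yz.2)) * Real.exp (-(δ / 2) * l1 (c - yz.2)) :=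
        (summable_exp_shift' (half_pos hδ) yz.2).mul_right _
      calc ∑' y₁ : Site (d + 1), Real.exp (-δ * l1 (y₁ - c)) * Real.exp (-δ * l1 (y₁ - yz.2))
          ≤ ∑' y₁ : Site (d + 1), Real.exp (-(δ / 2) * l1 (y₁ - yz.2)) * Real.exp (-(δ / 2) * l1 (c - yz.2)) := Summable.tsum_le_tsum hpt hs1 hs2
        _ = Zl (d + 1) (δ / 2) * Real.exp (-(δ / 2) * l1 (c - yz.2)) := by rw [tsum_mul_right, tsum_exp_shift']
  have hSum : ∀ a b, Summable (Ψ a b) := fun a b =>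
    Summable.of_norm_bounded hMjs (fun p => by rw [Real.norm_eq_abs]; exact hΨle a b p)
  -- the swapped arrangement `(y₁, (y, z))`
  let e : Site (d + 1) × (Site (d + 1) × Site (d + 1)) ≃ (Site (d + 1) × Site (d + 1)) × Site (d + 1) :=
    { toFun := fun q => (q.2, q.1)
      invFun := fun p => (p.2, p.1)
      left_inv := fun q => rfl
      right_inv := fun p => rfl }
  have hSum' : ∀ a b, Summable (fun q : Site (d + 1) × (Site (d + 1) × Site (d + 1)) => Ψ a b (e q)) := fun a b => (e.summable_iff (f := Ψ a b)).2 (hSum a b)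
  have hy1 : ∀ a b (yz : Site (d + 1) × Site (d + 1)), Summable fun y₁ : Site (d + 1) => Ψ a b (yz, y₁) := fun a b yz => (hSum a b).prod_factor yz
  have hyz : ∀ a b, Summable fun yz : Site (d + 1) × Site (d + 1) => ∑' y₁ : Site (d + 1), Ψ a b (yz, y₁) := fun a b => (hSum a b).prod
  have hyz' : ∀ a b (y₁ : Site (d + 1)), Summable fun yz : Site (d + 1) × Site (d + 1) => Ψ a b (yz, y₁) := fun a b y₁ => (hSum' a b).prod_factor y₁
  have hy1' : ∀ a b, Summable fun y₁ : Site (d + 1) => ∑' yz : Site (d + 1) × Site (d + 1), Ψ a b (yz, y₁) := fun a b => (hSum' a b).prod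
  have htot : ∀ a b, ∑' y₁ : Site (d + 1), ∑' yz : Site (d + 1) × Site (d + 1), Ψ a b (yz, y₁) = ∑' p, Ψ a b p := by
    intro a b
    rw [← e.tsum_eq (Ψ a b), (hSum' a b).tsum_prod]
    exact tsum_congr fun _ => tsum_congr fun _ => rfl
  -- the left arrangement
  have L : ∀ b, (∑' yz : Site (d + 1) × Site (d + 1), f yz.1 * (∑' y₁ : Site (d + 1), ∑ a, V yz.1 y₁ a * X y₁ yz.2 a b) * T b yz.2) = ∑ a, ∑' p, Ψ a b p := by
    intro b
    have e1 : ∀ yz : Site (d + 1) × Site (d + 1), f yz.1 * (∑' y₁ : Site (d + 1), ∑ a, V yz.1 y₁ a * X y₁ yz.2 a b) * T b yz.2 =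
        ∑ a, ∑' y₁ : Site (d + 1), Ψ a b (yz, y₁) := by
      intro yz
      rw [← Summable.tsum_finsetSum (fun a _ => hy1 a b yz), ← tsum_mul_left, ← tsum_mul_right]
      refine tsum_congr fun y₁ => ?_
      rw [Finset.mul_sum, Finset.sum_mul]
      exact Finset.sum_congr rfl fun a _ => by simp only [hΨ]; ring
    rw [tsum_congr e1, Summable.tsum_finsetSum (fun a _ => hyz a b)]
    exact Finset.sum_congr rfl fun a _ => (hSum a b).tsum_prod.symm
  -- the right arrangement
  have R : ∀ (y₁ : Site (d + 1)) (a : ι), (∑' y : Site (d + 1), f y * V y y₁ a) * (∑' z : Site (d + 1), ∑ b, X y₁ z a b * T b z) =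
      ∑ b, ∑' yz : Site (d + 1) × Site (d + 1), Ψ a b (yz, y₁) := by
    intro y₁ a
    have hF : Summable fun y : Site (d + 1) => ‖f y * V y y₁ a‖ := by
      refine Summable.of_nonneg_of_le (fun _ => norm_nonneg _) (fun y => ?_)
        (((summable_exp_shift' hδ c).mul_left Cv).mul_right (Real.exp (-δ * l1 (y₁ - c))))
      rw [Real.norm_eq_abs, abs_mul]
      have h2 := hV y y₁ a
      rw [mul_add, Real.exp_add, ← mul_assoc] at h2
      calc |f y| * |V y y₁ a| ≤ 1 * (Cv * Real.exp (-δ * l1 (y - c)) * Real.exp (-δ * l1 (y₁ - c))) := mul_le_mul (hf y) h2 (abs_nonneg _) zero_le_one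
        _ = _ := one_mul _
    have hG : Summable fun z : Site (d + 1) => ‖∑ b, X y₁ z a b * T b z‖ := by
      refine Summable.of_nonneg_of_le (fun _ => norm_nonneg _) (fun z => ?_)
        (((summable_exp_shift hδ y₁).mul_left ((Fintype.card ι : ℝ) * CX)).mul_right M)
      rw [Real.norm_eq_abs]
      calc |∑ b, X y₁ z a b * T b z| ≤ ∑ b, |X y₁ z a b * T b z| := Finset.abs_sum_le_sum_abs _ _
        _ ≤ ∑ _b : ι, CX * Real.exp (-δ * l1 (y₁ - z)) * M := Finset.sum_le_sum fun b _ => by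
            rw [abs_mul]; exact mul_le_mul (hX y₁ z a b) (hT b z) (abs_nonneg _) (by positivity)
        _ = (Fintype.card ι : ℝ) * CX * Real.exp (-δ * l1 (y₁ - z)) * M := by
            rw [Finset.sum_const, Finset.card_univ, nsmul_eq_mul]; ring
    have hFG : Summable fun yz : Site (d + 1) × Site (d + 1) => (f yz.1 * V yz.1 y₁ a) * (∑ b, X y₁ yz.2 a b * T b yz.2) :=
      summable_mul_of_summable_norm (f := fun y => f y * V y y₁ a) (g := fun z => ∑ b, X y₁ z a b * T b z) hF hG
    calc (∑' y : Site (d + 1), f y * V y y₁ a) * (∑' z : Site (d + 1), ∑ b, X y₁ z a b * T b z)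
        = ∑' y : Site (d + 1), (f y * V y y₁ a) * ∑' z : Site (d + 1), ∑ b, X y₁ z a b * T b z := by rw [← tsum_mul_right]
      _ = ∑' y : Site (d + 1), ∑' z : Site (d + 1), (f y * V y y₁ a) * (∑ b, X y₁ z a b * T b z) :=
          tsum_congr fun y => by rw [← tsum_mul_left]
      _ = ∑' yz : Site (d + 1) × Site (d + 1), (f yz.1 * V yz.1 y₁ a) * (∑ b, X y₁ yz.2 a b * T b yz.2) := hFG.tsum_prod.symm
      _ = ∑ b, ∑' yz : Site (d + 1) × Site (d + 1), Ψ a b (yz, y₁) := by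
          rw [← Summable.tsum_finsetSum (fun b _ => hyz' a b y₁)]
          refine tsum_congr fun yz => ?_
          rw [Finset.mul_sum]
          exact Finset.sum_congr rfl fun b _ => by simp only [hΨ]; ring
  -- assemble
  rw [Finset.sum_congr rfl fun b _ => L b, tsum_congr fun y₁ => Finset.sum_congr rfl fun a _ => R y₁ a,
    Summable.tsum_finsetSum (fun a _ => summable_sum fun b _ => hy1' a b), Finset.sum_comm]
  refine Finset.sum_congr rfl fun a _ => ?_
  rw [Summable.tsum_finsetSum (fun b _ => hy1' a b)]
  exact Finset.sum_congr rfl fun b _ => (htot a b).symm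

/-! ## §2 The outer Fubini for the dressed source -/

section Dressed

variable {Lc : ℕ} [NeZero Lc] {r : Fin (d + 1) → ℕ} {μ ν α β : Fin (d + 1)}

/-- [folklore] **THE OUTER FUBINI** (in-block root, `1 ≤ Lc`, all units, `ν ≠ β`, fixed first bond `(μ, u)`): the literal two-face-read word summed over its second bond IS the reduced
word of `EEWordReduced` — `ExchangeSlotLiteral.hasSum_literal_slot` ⨾ `ExchangeFieldLegs.tsum_prod_faceHalfVertex` ⨾ `fubini3` (decay data of the dressed source; the resummed right
slot is the bounded block-periodic current `K₁·(+½·curvAdj F_{νβ})`). -/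
theorem ee_word_outer_fubini (hνβ : ν ≠ β) (hLc : 1 ≤ Lc) (hr : r ∈ box (d + 1) Lc) (sf sm cE : ℝ) (u : Site (d + 1)) :
    ∑' u' : Site (d + 1), ∑' yw : Site (d + 1) × Site (d + 1), (if yw.1 α % (Lc : ℤ) = (Lc : ℤ) - 1 then (1 : ℝ) else 0) * (if yw.2 β % (Lc : ℤ) = (Lc : ℤ) - 1 then (1 : ℝ) else 0) *
        comp (comp (vertexOfK (unitK sf sm (coDressKBmAt (toSite r) Lc (KInvStep (d := d) Lc 0))) Lc (unitS sf sm (fun κ v => cE • wilsonA d κ v)) μ u) (unitK sf sm (coDressKBmAt (toSite r) Lc (KInvStep (d := d) Lc 0)))) (vertexOfK (unitK sf sm (coDressKBmAt (toSite r) Lc (KInvStep (d := d) Lc 0))) Lc (unitS sf sm (fun κ v => cE • wilsonA d κ v)) ν u') yw.1 yw.2 (Sum.inl α) (Sum.inl β) =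
      ∑' y₁ : Site (d + 1), ∑ a : Fin (d + 1),
        (∑' y : Site (d + 1), (if y α % (Lc : ℤ) = (Lc : ℤ) - 1 then (1 : ℝ) else 0) * vertexOfK (unitK sf sm (coDressKBmAt (toSite r) Lc (KInvStep (d := d) Lc 0))) Lc (unitS sf sm (fun κ v => cE • wilsonA d κ v)) μ u y y₁ (Sum.inl α) (Sum.inl a)) *
        (∑' z : Site (d + 1), ∑ b : Fin (d + 1), unitK sf sm (coDressKBmAt (toSite r) Lc (KInvStep (d := d) Lc 0)) y₁ z (Sum.inl a) (Sum.inl b) *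
          (∑' u' : Site (d + 1), ∑' w : Site (d + 1), (if w β % (Lc : ℤ) = (Lc : ℤ) - 1 then (1 : ℝ) else 0) * vertexOfK (unitK sf sm (coDressKBmAt (toSite r) Lc (KInvStep (d := d) Lc 0))) Lc (unitS sf sm (fun κ v => cE • wilsonA d κ v)) ν u' z w (Sum.inl b) (Sum.inl β))) := by
  classical
  rw [(hasSum_literal_slot (μ := μ) (ν := ν) (α := α) (β := β) hLc hr sf sm cE 0 u).tsum_eq]
  simp only [tsum_prod_faceHalfVertex hLc hr sf sm cE 0 ν β]
  -- decay data at one rate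
  obtain ⟨δK, CK, hδK, hCK, hXd⟩ := decays_coDressKBmAt hLc hr (decays_KInvStep (d := d) (Lc := Lc) 0)
  have hXu := decays_unitK (sf := sf) (sm := sm) hXd
  have hS := locStencil_unitS (sf := sf) (sm := sm) (locStencil_smul cE (locStencil_wilsonA (d := d) hδK.le))
  have hC : 0 ≤ max |sf| |sm| * CK * max |sf| |sm| := by positivity
  obtain ⟨Cv, hVF⟩ : ∃ Cv : ℝ, VertexFamily (vertexOfK (unitK sf sm (coDressKBmAt (toSite r) Lc (KInvStep (d := d) Lc 0))) Lc (unitS sf sm (fun κ v => cE • wilsonA d κ v))) Lc Cv (δK / 2) :=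
    ⟨_, vertexFamily_vertexOfK (N := Lc) hXu hC hS hδK le_rfl⟩
  have hCv : 0 ≤ Cv := (hVF μ 0).nonneg (Sum.inl 0)
  have hXu' : Decays (unitK sf sm (coDressKBmAt (toSite r) Lc (KInvStep (d := d) Lc 0))) (max |sf| |sm| * CK * max |sf| |sm|) (δK / 2) := decays_mono hXu hC le_rfl (by linarith)
  -- the resummed right slot is a bounded block-periodic current
  have hGp : ∀ κ l, IsPeriodic Lc ((fun κ l (x : Site (d + 1)) =>
            (if κ = ν ∧ l = β then (if x ν % (Lc : ℤ) = (Lc : ℤ) - 1 then (1 : ℝ) else 0) * (if x β % (Lc : ℤ) = (Lc : ℤ) - 1 then (1 : ℝ) else 0) else 0) -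
            (if κ = β ∧ l = ν then (if x ν % (Lc : ℤ) = (Lc : ℤ) - 1 then (1 : ℝ) else 0) * (if x β % (Lc : ℤ) = (Lc : ℤ) - 1 then (1 : ℝ) else 0) else 0)) κ l) := facePlaq_periodic (d := d) Lc ν β
  have hT : ∀ (b : Fin (d + 1)) (z : Site (d + 1)),
      |∑' u' : Site (d + 1), ∑' w : Site (d + 1), (if w β % (Lc : ℤ) = (Lc : ℤ) - 1 then (1 : ℝ) else 0) * vertexOfK (unitK sf sm (coDressKBmAt (toSite r) Lc (KInvStep (d := d) Lc 0))) Lc (unitS sf sm (fun κ v => cE • wilsonA d κ v)) ν u' z w (Sum.inl b) (Sum.inl β)| ≤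
        ∑ b' : Fin (d + 1), ∑ r' ∈ box (d + 1) Lc, |((((Lc : ℝ) * (sm * sf)) * ((((Lc ^ (0 + 1) : ℕ) : ℝ)) ^ (d + 1 + 1))⁻¹) * ((sf * sm)⁻¹ * (sf⁻¹ * sf⁻¹) * cE)) * ((1 / 2 : ℝ) * curvAdj (fun κ l (x : Site (d + 1)) =>
            (if κ = ν ∧ l = β then (if x ν % (Lc : ℤ) = (Lc : ℤ) - 1 then (1 : ℝ) else 0) * (if x β % (Lc : ℤ) = (Lc : ℤ) - 1 then (1 : ℝ) else 0) else 0) -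
            (if κ = β ∧ l = ν then (if x ν % (Lc : ℤ) = (Lc : ℤ) - 1 then (1 : ℝ) else 0) * (if x β % (Lc : ℤ) = (Lc : ℤ) - 1 then (1 : ℝ) else 0) else 0)) b' (toSite r'))| := by
    intro b z
    rw [(hasSum_faceHalfVertex_snd hνβ hLc hr sf sm cE 0 b z).tsum_eq]
    have hb := bounded_of_periodic (Lc := Lc) (V := fun z => ((((Lc : ℝ) * (sm * sf)) * ((((Lc ^ (0 + 1) : ℕ) : ℝ)) ^ (d + 1 + 1))⁻¹) * ((sf * sm)⁻¹ * (sf⁻¹ * sf⁻¹) * cE)) * ((1 / 2 : ℝ) * curvAdj (fun κ l (x : Site (d + 1)) =>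
            (if κ = ν ∧ l = β then (if x ν % (Lc : ℤ) = (Lc : ℤ) - 1 then (1 : ℝ) else 0) * (if x β % (Lc : ℤ) = (Lc : ℤ) - 1 then (1 : ℝ) else 0) else 0) -
            (if κ = β ∧ l = ν then (if x ν % (Lc : ℤ) = (Lc : ℤ) - 1 then (1 : ℝ) else 0) * (if x β % (Lc : ℤ) = (Lc : ℤ) - 1 then (1 : ℝ) else 0) else 0)) b z)) (fun z s => by
      have h := smul_curvAdj_periodic (N := Lc) hGp (1 / 2 : ℝ) b z s
      show ((((Lc : ℝ) * (sm * sf)) * ((((Lc ^ (0 + 1) : ℕ) : ℝ)) ^ (d + 1 + 1))⁻¹) * ((sf * sm)⁻¹ * (sf⁻¹ * sf⁻¹) * cE)) * ((1 / 2 : ℝ) * curvAdj (fun κ l (x : Site (d + 1)) =>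
            (if κ = ν ∧ l = β then (if x ν % (Lc : ℤ) = (Lc : ℤ) - 1 then (1 : ℝ) else 0) * (if x β % (Lc : ℤ) = (Lc : ℤ) - 1 then (1 : ℝ) else 0) else 0) -
            (if κ = β ∧ l = ν then (if x ν % (Lc : ℤ) = (Lc : ℤ) - 1 then (1 : ℝ) else 0) * (if x β % (Lc : ℤ) = (Lc : ℤ) - 1 then (1 : ℝ) else 0) else 0)) b (z + (Lc : ℤ) • s)) = _
      rw [h]) z
    exact hb.trans (Finset.single_le_sum (f := fun b' => ∑ r' ∈ box (d + 1) Lc, |((((Lc : ℝ) * (sm * sf)) * ((((Lc ^ (0 + 1) : ℕ) : ℝ)) ^ (d + 1 + 1))⁻¹) * ((sf * sm)⁻¹ * (sf⁻¹ * sf⁻¹) * cE)) * ((1 / 2 : ℝ) * curvAdj (fun κ l (x : Site (d + 1)) =>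
            (if κ = ν ∧ l = β then (if x ν % (Lc : ℤ) = (Lc : ℤ) - 1 then (1 : ℝ) else 0) * (if x β % (Lc : ℤ) = (Lc : ℤ) - 1 then (1 : ℝ) else 0) else 0) -
            (if κ = β ∧ l = ν then (if x ν % (Lc : ℤ) = (Lc : ℤ) - 1 then (1 : ℝ) else 0) * (if x β % (Lc : ℤ) = (Lc : ℤ) - 1 then (1 : ℝ) else 0) else 0)) b' (toSite r'))|)
      (fun b' _ => Finset.sum_nonneg fun _ _ => abs_nonneg _) (Finset.mem_univ b))
  exact fubini3 (f := fun y => (if y α % (Lc : ℤ) = (Lc : ℤ) - 1 then (1 : ℝ) else 0)) (V := fun y y₁ a => vertexOfK (unitK sf sm (coDressKBmAt (toSite r) Lc (KInvStep (d := d) Lc 0))) Lc (unitS sf sm (fun κ v => cE • wilsonA d κ v)) μ u y y₁ (Sum.inl α) (Sum.inl a))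
    (X := fun y₁ z a b => unitK sf sm (coDressKBmAt (toSite r) Lc (KInvStep (d := d) Lc 0)) y₁ z (Sum.inl a) (Sum.inl b))
    (T := fun b z => ∑' u' : Site (d + 1), ∑' w : Site (d + 1), (if w β % (Lc : ℤ) = (Lc : ℤ) - 1 then (1 : ℝ) else 0) * vertexOfK (unitK sf sm (coDressKBmAt (toSite r) Lc (KInvStep (d := d) Lc 0))) Lc (unitS sf sm (fun κ v => cE • wilsonA d κ v)) ν u' z w (Sum.inl b) (Sum.inl β))
    (c := (Lc : ℤ) • u) (half_pos hδK) hCv hC (Finset.sum_nonneg fun _ _ => Finset.sum_nonneg fun _ _ => abs_nonneg _)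
    (fun y => by split_ifs <;> simp) (fun y y₁ a => hVF μ u y y₁ (Sum.inl α) (Sum.inl a)) (fun y₁ z a b => hXu' y₁ z (Sum.inl a) (Sum.inl b)) hT

/-! ## §3 The number -/

/-- [folklore] **THE EE EXCHANGE WORD OF THE DRESSED LEVEL-0 SOURCE IS ONE NUMBER** (in-block root `ρ = toSite r`, `1 ≤ Lc`, all units `s_f s_m cE`, `μ ≠ α`, `ν ≠ β`):
`Σ_{u ∈ box Lc} Σ'_{u′} Σ'_{(y,w)} 𝟙f(y_α)𝟙f(w_β)·((V_{μ,u} ∘ X̃♮_0) ∘ V_{ν,u′}) y w (inl α)(inl β) = −K₁²·s_f²·E·½·Lc^{d−1}·(Lc^{d+1} − Lc^{d−1})`, `E = [μ=ν][α=β] − [μ=β][α=ν]`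
(`ee_word_outer_fubini` per first bond ⨾ `EEWordReduced.ee_word_reduced′`) — blueprint §5 as corrected by C-leaf04-g65-1 (the factor `|box Lc| = Lc^{d+1}`). -/
theorem ee_word_value (hμα : μ ≠ α) (hνβ : ν ≠ β) (hLc : 1 ≤ Lc) (hr : r ∈ box (d + 1) Lc) (sf sm cE : ℝ) :
    ∑ u ∈ box (d + 1) Lc, ∑' u' : Site (d + 1), ∑' yw : Site (d + 1) × Site (d + 1), (if yw.1 α % (Lc : ℤ) = (Lc : ℤ) - 1 then (1 : ℝ) else 0) * (if yw.2 β % (Lc : ℤ) = (Lc : ℤ) - 1 then (1 : ℝ) else 0) *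
        comp (comp (vertexOfK (unitK sf sm (coDressKBmAt (toSite r) Lc (KInvStep (d := d) Lc 0))) Lc (unitS sf sm (fun κ v => cE • wilsonA d κ v)) μ (toSite u)) (unitK sf sm (coDressKBmAt (toSite r) Lc (KInvStep (d := d) Lc 0)))) (vertexOfK (unitK sf sm (coDressKBmAt (toSite r) Lc (KInvStep (d := d) Lc 0))) Lc (unitS sf sm (fun κ v => cE • wilsonA d κ v)) ν u') yw.1 yw.2 (Sum.inl α) (Sum.inl β) =
      -(((((Lc : ℝ) * (sm * sf)) * ((((Lc ^ (0 + 1) : ℕ) : ℝ)) ^ (d + 1 + 1))⁻¹) * ((sf * sm)⁻¹ * (sf⁻¹ * sf⁻¹) * cE))) ^ 2 * (sf * sf) *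
        (((if μ = ν ∧ α = β then (1 : ℝ) else 0) - (if μ = β ∧ α = ν then (1 : ℝ) else 0)) * ((1 / 2 : ℝ) * (Lc : ℝ) ^ (d - 1) * ((Lc : ℝ) ^ (d + 1) - (Lc : ℝ) ^ (d - 1)))) := by
  rw [Finset.sum_congr rfl fun u _ => ee_word_outer_fubini (μ := μ) (ν := ν) (α := α) (β := β) hνβ hLc hr sf sm cE (toSite u)]
  exact ee_word_reduced' hμα hνβ hLc hr sf sm cE

end Dressed

end Summit.QuantumFields.BalabanUV.Beta.GAN24.EEWordValue

end
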